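import Literature.Analysis.FluidPDE.PassiveVectorTensorUniqueness
import Literature.Analysis.FluidPDE.PassiveVectorTestForms
import Literature.Analysis.FunctionSpaces.TorusTruncationH1
import HarnessLib

/-!
# Gårding's inequality for a constant Legendre–Hadamard viscosity tensor on divergence-free fields,
# and the coercive space–time form of the tensor passive-vector equation

Analysis/FluidPDE proof-support file (everything proved; no definitions, no named facts). For a
constant fourth-order tensor `𝔸` in a Legendre–Hadamard window `NearIso 𝔸 lo hi` (Frisch's
anisotropic eddy viscosity (9.57); NO symmetry assumed) the formal adjoint `𝓛_𝔸^*` (`viscAdj 𝔸`) is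
dissipative on smooth DIVERGENCE-FREE vector fields of the torus:

  `∫ ⟪ψ, 𝓛_𝔸^* ψ⟫ ≤ -lo ‖∇ψ‖₂²`   (`integral_inner_viscAdj_self_le`),

Gårding's inequality without lower-order term for constant coefficients (Giaquinta 1983, Ch. III §2,
(2.2) ⇒ (2.6) by Fourier transform): in Fourier variables `∫⟪P_N ψ, 𝓛_𝔸^* ψ⟫ =
-4π² ∑_{|k|≤N} Re⟪ψ̂(k), T_{𝔸ᵀ}(k) ψ̂(k)⟫` (`integral_inner_fourierTruncate_viscAdj_eq`; the symbol of
the major transpose, `viscOp 𝔸 = viscAdj 𝔸ᵀ`), each term is `≤ -4π² lo |k|² ‖ψ̂(k)‖²` because the modes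
of a divergence-free field are transversal (`lo_mul_le_re_inner_symbT`, `NearIso` is invariant under
the major transpose), and `N → ∞` (Parseval, `P_N ψ → ψ` in `Ḣ¹`). Rank-one (Legendre–Hadamard)
coercivity does NOT give a pointwise sign of `∇ψ : 𝔸 : ∇ψ`; the inequality is genuinely integrated.

Consequence (`setIntegral_tensorForm_ge`): the damped space–time form of the tensor passive-vector
equation is coercive on divergence-free tests — for `T > 0`, `0 ≤ lo`, a bounded carrier `b` weakly
divergence free at a.e. time and a divergence-free space–time test `ψ` on `[0,T)`,
`∫_{(0,T)}∫‖ψ‖² + ½∫‖ψ(0)‖² ≤ -∫_{(0,T)}∫⟪ψ, ∂ₜψ - ψ + (b·∇)ψ + 𝓛_𝔸^* ψ⟫`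
(Lions–Magenes 1972, Chap. 3 (4.19)–(4.21), with `νΔ` replaced by `𝓛_𝔸^*`). This is the input of
J.-L. Lions' projection theorem for the EXISTENCE of weak tensor-class solutions
(`IsWeakTensorPassiveVectorOn`; the tensor twin of `PassiveVectorLionsWeak`, to follow), needed by the
K1L one-level step (`stub_oneLevelL`/`stub_cellEnergyT`, cell `ad-ideate`).

## Mathlib / tree search

Tree: `PassiveVectorTensor` (`viscAdj`, `viscOp`, `majorTranspose`, `nearIso_majorTranspose_iff`,
`integral_inner_viscOp_eq_integral_inner_viscAdj`, `viscAdj_add_field`, `isSpaceTimeTest_viscAdj`),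
`PassiveVectorTensorFourier` (`integral_inner_viscAdj_realTrigPoly_singleton`),
`PassiveVectorTensorUniqueness` (`lo_mul_le_re_inner_symbT`), `PassiveVectorTestForms` (time-derivative
and transport parts of the form), `TorusTruncationH1` (`tendsto_gradNormSq_fourierTruncate`),
`TorusVectorParseval` (`hasSum_re_inner_mFourierCoeff_complexify`).

## References

* M. Giaquinta, *Multiple integrals in the calculus of variations and nonlinear elliptic systems*
  (Princeton 1983), Ch. III §2, (2.2)–(2.6). [`Giaquinta1983MultipleIntegrals`]
* J.-L. Lions, E. Magenes, *Non-homogeneous boundary value problems* I (1972), Chap. 3 Thm. 1.1,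
  §4.3 (4.19)–(4.21). [`LionsMagenes1972`]
* U. Frisch, *Turbulence* (CUP 1995), §9.6.3 eq. (9.57) p. 233. [`Frisch1995Turbulence`]
* R. Temam, *Navier–Stokes Equations*, 3rd ed. (1984), Ch. III §1.1 (1.30)–(1.33). [`Temam1984`]
-/

noncomputable section

open MeasureTheory Set Filter Function TopologicalSpace Complex UnitAddTorus
open scoped ENNReal NNReal InnerProductSpace ComplexConjugate Topology

namespace Literature.Analysis.FluidPDE

namespace Torus

variable {d : Type*} [Fintype d] [DecidableEq d]

/-! ## The adjoint viscous operator on finite sums and truncations -/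

/-- `viscAdj 𝔸` is additive over finite sums of smooth fields (and the sum is smooth). [folklore] -/
private theorem viscAdj_finset_sum₉ {ι : Type*} (𝔸 : Visc4 d) (s : Finset ι)
    {f : ι → UnitAddTorus d → EuclideanSpace ℝ d} (hf : ∀ i, FunctionSpaces.Torus.IsSmooth (f i)) :
    FunctionSpaces.Torus.IsSmooth (fun y => ∑ i ∈ s, f i y) ∧
      ∀ x, viscAdj 𝔸 (fun y => ∑ i ∈ s, f i y) x = ∑ i ∈ s, viscAdj 𝔸 (f i) x := by
  classical
  induction s using Finset.induction_on with
  | empty =>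
    refine ⟨?_, fun x => ?_⟩
    · simp only [Finset.sum_empty]
      exact (contDiff_const : ContDiff ℝ _ fun _ : EuclideanSpace ℝ d => (0 : EuclideanSpace ℝ d))
    · simp only [Finset.sum_empty]
      exact viscAdj_zero_field 𝔸 x
  | insert a s ha ih =>
    have e : (fun y => ∑ i ∈ insert a s, f i y) = f a + fun y => ∑ i ∈ s, f i y := by
      funext y; rw [Finset.sum_insert ha]; rfl
    refine ⟨?_, fun x => ?_⟩
    · rw [e]; exact (hf a).add ih.1
    · rw [e, viscAdj_add_field 𝔸 (hf a) ih.1 x, ih.2 x, Finset.sum_insert ha]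

omit [DecidableEq d] in
/-- `viscOp 𝔸 = viscAdj 𝔸ᵀ` on smooth fields (major transpose). [folklore] -/
private theorem viscOp_eq_viscAdj_majorTranspose₉ [DecidableEq d] (𝔸 : Visc4 d)
    {Ψ : UnitAddTorus d → EuclideanSpace ℝ d} (hΨ : FunctionSpaces.Torus.IsSmooth Ψ) (x : UnitAddTorus d) :
    viscOp 𝔸 Ψ x = viscAdj (majorTranspose 𝔸) Ψ x := by
  rw [viscAdj_eq_viscOp_majorTranspose (majorTranspose 𝔸) hΨ, majorTranspose_majorTranspose]

/-- **The truncated pairing in Fourier variables**: for a smooth field `ψ` and every `N`,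
`∫ ⟪P_N ψ, 𝓛_𝔸^* ψ⟫ = ∑_{|k|≤N} Re( -4π² ⟪ψ̂(k), T_{𝔸ᵀ}(k) ψ̂(k)⟫ )`
(`∫⟪P_Nψ, 𝓛_𝔸^*ψ⟫ = ∫⟪𝓛_𝔸 P_Nψ, ψ⟫ = ∫⟪ψ, 𝓛_{𝔸ᵀ}^* P_Nψ⟫` and the single-mode symbol).
[cite: Giaquinta1983MultipleIntegrals, Ch. III §2 eq. (2.2)] -/
theorem integral_inner_fourierTruncate_viscAdj_eq (𝔸 : Visc4 d) {ψ : UnitAddTorus d → EuclideanSpace ℝ d}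
    (hψ : FunctionSpaces.Torus.IsSmooth ψ) (N : ℕ) :
    ∫ x, ⟪FunctionSpaces.Torus.fourierTruncate N ψ x, viscAdj 𝔸 ψ x⟫_ℝ =
      ∑ k ∈ FunctionSpaces.Torus.freqBall N, ((-(4 * Real.pi ^ 2 : ℝ) : ℂ) *
        ⟪mFourierCoeff (FunctionSpaces.EuclideanSpace.complexify ∘ ψ) k,
          symbT (majorTranspose 𝔸) k (mFourierCoeff (FunctionSpaces.EuclideanSpace.complexify ∘ ψ) k)⟫_ℂ).re := by
  set c : (d → ℤ) → EuclideanSpace ℂ d := fun k => mFourierCoeff (FunctionSpaces.EuclideanSpace.complexify ∘ ψ) k with hc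
  have hPs : FunctionSpaces.Torus.IsSmooth (FunctionSpaces.Torus.fourierTruncate N ψ) :=
    FunctionSpaces.Torus.isSmooth_fourierTruncate N ψ
  have hsing : ∀ k : d → ℤ, FunctionSpaces.Torus.IsSmooth (FunctionSpaces.Torus.realTrigPoly {k} c) :=
    fun k => FunctionSpaces.Torus.isSmooth_realTrigPoly _ _
  have hPsum : FunctionSpaces.Torus.fourierTruncate N ψ =
      fun y => ∑ k ∈ FunctionSpaces.Torus.freqBall N, FunctionSpaces.Torus.realTrigPoly {k} c y := by
    funext y
    rw [FunctionSpaces.Torus.fourierTruncate_eq, FunctionSpaces.Torus.realTrigPoly_apply_eq_sum]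
    refine Finset.sum_congr rfl fun k _ => ?_
    rw [FunctionSpaces.Torus.realTrigPoly_apply_eq_sum, Finset.sum_singleton]
  obtain ⟨-, hadd⟩ := viscAdj_finset_sum₉ (majorTranspose 𝔸) (FunctionSpaces.Torus.freqBall N) hsing
  -- `∫⟪P_Nψ, 𝓛^*ψ⟫ = ∫⟪ψ, 𝓛_{𝔸ᵀ}^* P_Nψ⟫`
  have h1 : ∫ x, ⟪FunctionSpaces.Torus.fourierTruncate N ψ x, viscAdj 𝔸 ψ x⟫_ℝ =
      ∫ x, ⟪ψ x, viscAdj (majorTranspose 𝔸) (FunctionSpaces.Torus.fourierTruncate N ψ) x⟫_ℝ := by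
    rw [← integral_inner_viscOp_eq_integral_inner_viscAdj 𝔸 hPs hψ]
    refine integral_congr_ae (ae_of_all _ fun x => ?_)
    dsimp only
    rw [viscOp_eq_viscAdj_majorTranspose₉ 𝔸 hPs x, real_inner_comm]
  rw [h1]
  -- expand the truncation into single modes
  have h2 : ∀ x, ⟪ψ x, viscAdj (majorTranspose 𝔸) (FunctionSpaces.Torus.fourierTruncate N ψ) x⟫_ℝ =
      ∑ k ∈ FunctionSpaces.Torus.freqBall N, ⟪ψ x, viscAdj (majorTranspose 𝔸) (FunctionSpaces.Torus.realTrigPoly {k} c) x⟫_ℝ := by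
    intro x
    rw [hPsum, hadd x, inner_sum]
  simp_rw [h2]
  rw [integral_finsetSum _ fun k _ => ?_]
  · exact Finset.sum_congr rfl fun k _ => integral_inner_viscAdj_realTrigPoly_singleton hψ.integrable _ k c
  · exact (hψ.continuous.inner (isSmooth_viscAdj _ (hsing k)).continuous).integrable_of_hasCompactSupport
      (HasCompactSupport.of_compactSpace _)

/-- **Gårding's inequality for a constant Legendre–Hadamard tensor on divergence-free fields**
(Giaquinta 1983, Ch. III §2: rank-one coercivity (2.2) gives the integrated coercivity (2.6) for
constant coefficients by Fourier transform; here on the torus, for the transversal modes of a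
divergence-free field): for `NearIso 𝔸 lo hi` and a smooth divergence-free `ψ`,
`∫ ⟪ψ, 𝓛_𝔸^* ψ⟫ ≤ -lo ‖∇ψ‖₂²`. [cite: Giaquinta1983MultipleIntegrals, Ch. III §2 eq. (2.2)–(2.6)]
[cite: Frisch1995Turbulence, §9.6.3 eq. (9.57) p. 233] -/
theorem integral_inner_viscAdj_self_le {𝔸 : Visc4 d} {lo hi : ℝ} (h𝔸 : NearIso 𝔸 lo hi)
    {ψ : UnitAddTorus d → EuclideanSpace ℝ d} (hψ : FunctionSpaces.Torus.IsSmooth ψ)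
    (hdiv : FunctionSpaces.Torus.IsDivFree ψ) :
    ∫ x, ⟪ψ x, viscAdj 𝔸 ψ x⟫_ℝ ≤ -(lo * FunctionSpaces.Torus.gradNormSq ψ) := by
  have hψi : Integrable ψ volume := hψ.integrable
  have hψ2 : MemLp ψ 2 volume := hψ.memLp 2
  have hV : FunctionSpaces.Torus.IsSmooth (viscAdj 𝔸 ψ) := isSmooth_viscAdj 𝔸 hψ
  have hV2 : MemLp (viscAdj 𝔸 ψ) 2 volume := hV.memLp 2
  have h𝔸T : NearIso (majorTranspose 𝔸) lo hi := (nearIso_majorTranspose_iff 𝔸 lo hi).2 h𝔸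
  have htr : ∀ k : d → ℤ, ∑ j, (k j : ℂ) * mFourierCoeff (FunctionSpaces.EuclideanSpace.complexify ∘ ψ) k j = 0 :=
    fun k => (FunctionSpaces.Torus.IsDivFree.isWeaklyDivFree_holds hψ hdiv).sum_mul_mFourierCoeff_eq_zero hψ2 k
  -- the truncated pairings are `≤ -lo ‖∇P_Nψ‖²`
  have hN : ∀ N : ℕ, ∫ x, ⟪FunctionSpaces.Torus.fourierTruncate N ψ x, viscAdj 𝔸 ψ x⟫_ℝ ≤
      -(lo * FunctionSpaces.Torus.gradNormSq (FunctionSpaces.Torus.fourierTruncate N ψ)) := by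
    intro N
    rw [integral_inner_fourierTruncate_viscAdj_eq 𝔸 hψ N, gradNormSq_fourierTruncate,
      FunctionSpaces.Torus.fourierTruncate_eq,
      FunctionSpaces.Torus.toReal_eGradNormSq_realTrigPoly FunctionSpaces.Torus.neg_mem_freqBall_of_mem
        (FunctionSpaces.Torus.isConjSymm_mFourierCoeff hψi),
      ← mul_assoc, mul_comm lo, mul_assoc, Finset.mul_sum, ← neg_mul, Finset.mul_sum]
    refine Finset.sum_le_sum fun k _ => ?_
    rw [neg_mul, Complex.neg_re, Complex.re_ofReal_mul, neg_mul]
    have h := lo_mul_le_re_inner_symbT h𝔸T (htr k)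
    have h' := mul_le_mul_of_nonneg_left h (by positivity : (0 : ℝ) ≤ 4 * Real.pi ^ 2)
    linarith
  -- limits `N → ∞`
  have hlim1 : Tendsto (fun N : ℕ => ∫ x, ⟪FunctionSpaces.Torus.fourierTruncate N ψ x, viscAdj 𝔸 ψ x⟫_ℝ) atTop
      (𝓝 (∫ x, ⟪ψ x, viscAdj 𝔸 ψ x⟫_ℝ)) := by
    have h := (FunctionSpaces.Torus.hasSum_re_inner_mFourierCoeff_complexify hψ2 hV2).comp
      FunctionSpaces.Torus.tendsto_freqBall_atTop
    refine h.congr fun N => ?_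
    rw [Function.comp_apply, FunctionSpaces.Torus.integral_inner_fourierTruncate_left hψi hV2 N]
  have hlim2 : Tendsto (fun N : ℕ => -(lo * FunctionSpaces.Torus.gradNormSq (FunctionSpaces.Torus.fourierTruncate N ψ)))
      atTop (𝓝 (-(lo * FunctionSpaces.Torus.gradNormSq ψ))) :=
    ((FunctionSpaces.Torus.tendsto_gradNormSq_fourierTruncate hψ).const_mul lo).neg
  exact le_of_tendsto_of_tendsto' hlim1 hlim2 hN

/-- Gårding's inequality, nonnegative window: `∫ ⟪ψ, 𝓛_𝔸^* ψ⟫ ≤ 0` for `0 ≤ lo` and smooth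
divergence-free `ψ`. [cite: Giaquinta1983MultipleIntegrals, Ch. III §2 eq. (2.2)–(2.6)] -/
theorem integral_inner_viscAdj_self_nonpos {𝔸 : Visc4 d} {lo hi : ℝ} (h𝔸 : NearIso 𝔸 lo hi) (hlo : 0 ≤ lo)
    {ψ : UnitAddTorus d → EuclideanSpace ℝ d} (hψ : FunctionSpaces.Torus.IsSmooth ψ)
    (hdiv : FunctionSpaces.Torus.IsDivFree ψ) :
    ∫ x, ⟪ψ x, viscAdj 𝔸 ψ x⟫_ℝ ≤ 0 :=
  (integral_inner_viscAdj_self_le h𝔸 hψ hdiv).trans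
    (neg_nonpos.2 (mul_nonneg hlo (FunctionSpaces.Torus.gradNormSq_nonneg _)))

/-- The viscous term of the space–time form is dissipative for divergence-free tests:
`∫_{(0,T)} ∫ ⟪ψ(t), 𝓛_𝔸^* ψ(t)⟫ ≤ 0`. [cite: LionsMagenes1972, Chap. 3 §4.3 (4.19)–(4.21)] -/
theorem setIntegral_integral_inner_viscAdj_self_nonpos {𝔸 : Visc4 d} {lo hi : ℝ} (h𝔸 : NearIso 𝔸 lo hi)
    (hlo : 0 ≤ lo) {T : ℝ} {ψ : ℝ → UnitAddTorus d → EuclideanSpace ℝ d}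
    (hψ : FunctionSpaces.Torus.IsSpaceTimeTest T ψ) (hψdiv : FunctionSpaces.Torus.IsDivFreeTest ψ) :
    ∫ t in Ioo 0 T, ∫ x, ⟪ψ t x, viscAdj 𝔸 (ψ t) x⟫_ℝ ≤ 0 :=
  setIntegral_nonpos measurableSet_Ioo fun t _ =>
    integral_inner_viscAdj_self_nonpos h𝔸 hlo (hψ.isSmooth_slice t) (hψdiv t)

/-! ## The coercive space–time form -/

/-- **Coercivity of the damped tensor passive-vector form on divergence-free tests**
(Lions–Magenes 1972, Chap. 3, (4.19)–(4.21), with `νΔ` replaced by the anisotropic `𝓛_𝔸^*`): for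
`T > 0`, `NearIso 𝔸 lo hi` with `0 ≤ lo`, a carrier `b` bounded a.e. on `(0,T) × T^d` and weakly
divergence free for a.e. `t`, and a divergence-free space–time test `ψ` on `[0,T)`,
`∫_{(0,T)}∫‖ψ‖² + ½∫‖ψ(0)‖² ≤ -∫_{(0,T)} ∫ ⟪ψ, ∂ₜψ - ψ + (b·∇)ψ + 𝓛_𝔸^* ψ⟫`.
[cite: LionsMagenes1972, Chap. 3 Thm. 1.1 and §4.3] -/
theorem setIntegral_tensorForm_ge {T : ℝ} (hT : 0 < T) {𝔸 : Visc4 d} {lo hi : ℝ} (h𝔸 : NearIso 𝔸 lo hi)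
    (hlo : 0 ≤ lo) {b ψ : ℝ → UnitAddTorus d → EuclideanSpace ℝ d} (hψ : FunctionSpaces.Torus.IsSpaceTimeTest T ψ)
    (hψdiv : FunctionSpaces.Torus.IsDivFreeTest ψ)
    (hbdiv : ∀ᵐ t ∂(volume.restrict (Ioo 0 T)), FunctionSpaces.Torus.IsWeaklyDivFree (b t))
    (hbm : AEStronglyMeasurable (uncurry b) (((volume : Measure ℝ).restrict (Ioo 0 T)).prod volume)) {M : ℝ}
    (hbM : ∀ᵐ p ∂(((volume : Measure ℝ).restrict (Ioo 0 T)).prod (volume : Measure (UnitAddTorus d))),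
      ‖uncurry b p‖ ≤ M) :
    (∫ t in Ioo 0 T, ∫ x, ‖ψ t x‖ ^ 2) + (1 / 2) * ∫ x, ‖ψ 0 x‖ ^ 2 ≤
      -(∫ t in Ioo 0 T, ∫ x, ⟪ψ t x, FunctionSpaces.Torus.timeDeriv ψ t x - ψ t x +
          FunctionSpaces.Torus.convect (b t) (ψ t) x + viscAdj 𝔸 (ψ t) x⟫_ℝ) := by
  -- slice integrability
  have hcψ : Continuous (uncurry ψ) := hψ.continuous_uncurry
  have hV : FunctionSpaces.Torus.IsSpaceTimeTest T (fun t => viscAdj 𝔸 (ψ t)) := isSpaceTimeTest_viscAdj 𝔸 hψ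
  have iA : ∀ t, Integrable (fun x => ⟪ψ t x, FunctionSpaces.Torus.timeDeriv ψ t x⟫_ℝ) volume := fun t =>
    ((hψ.isSmooth_slice t).continuous.inner (hψ.timeDeriv.isSmooth_slice t).continuous).integrable_of_hasCompactSupport
      (HasCompactSupport.of_compactSpace _)
  have iS : ∀ t, Integrable (fun x => ⟪ψ t x, ψ t x⟫_ℝ) volume := fun t =>
    ((hψ.isSmooth_slice t).continuous.inner (hψ.isSmooth_slice t).continuous).integrable_of_hasCompactSupport
      (HasCompactSupport.of_compactSpace _)
  have iL : ∀ t, Integrable (fun x => ⟪ψ t x, viscAdj 𝔸 (ψ t) x⟫_ℝ) volume := fun t =>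
    ((hψ.isSmooth_slice t).continuous.inner (hV.isSmooth_slice t).continuous).integrable_of_hasCompactSupport
      (HasCompactSupport.of_compactSpace _)
  have hprod := integrable_inner_convect_self_prod hψ hbm hbM
  have iC : ∀ᵐ t ∂(volume.restrict (Ioo 0 T)),
      Integrable (fun x => ⟪ψ t x, FunctionSpaces.Torus.convect (b t) (ψ t) x⟫_ℝ) volume := hprod.prod_right_ae
  -- the slice identity
  have hslice : ∀ᵐ t ∂(volume.restrict (Ioo 0 T)),
      ∫ x, ⟪ψ t x, FunctionSpaces.Torus.timeDeriv ψ t x - ψ t x +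
          FunctionSpaces.Torus.convect (b t) (ψ t) x + viscAdj 𝔸 (ψ t) x⟫_ℝ =
        (∫ x, ⟪ψ t x, FunctionSpaces.Torus.timeDeriv ψ t x⟫_ℝ) - (∫ x, ‖ψ t x‖ ^ 2) +
          (∫ x, ⟪ψ t x, FunctionSpaces.Torus.convect (b t) (ψ t) x⟫_ℝ) +
            ∫ x, ⟪ψ t x, viscAdj 𝔸 (ψ t) x⟫_ℝ := by
    filter_upwards [iC] with t ht
    have e : (fun x => ⟪ψ t x, FunctionSpaces.Torus.timeDeriv ψ t x - ψ t x +
        FunctionSpaces.Torus.convect (b t) (ψ t) x + viscAdj 𝔸 (ψ t) x⟫_ℝ) =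
        fun x => ⟪ψ t x, FunctionSpaces.Torus.timeDeriv ψ t x⟫_ℝ - ⟪ψ t x, ψ t x⟫_ℝ +
          ⟪ψ t x, FunctionSpaces.Torus.convect (b t) (ψ t) x⟫_ℝ + ⟪ψ t x, viscAdj 𝔸 (ψ t) x⟫_ℝ := by
      funext x
      rw [inner_add_right, inner_add_right, inner_sub_right]
    have h12 : Integrable (fun x => ⟪ψ t x, FunctionSpaces.Torus.timeDeriv ψ t x⟫_ℝ - ⟪ψ t x, ψ t x⟫_ℝ) volume :=
      (iA t).sub (iS t)
    have h123 : Integrable (fun x => ⟪ψ t x, FunctionSpaces.Torus.timeDeriv ψ t x⟫_ℝ - ⟪ψ t x, ψ t x⟫_ℝ +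
        ⟪ψ t x, FunctionSpaces.Torus.convect (b t) (ψ t) x⟫_ℝ) volume := h12.add ht
    rw [e, integral_add h123 (iL t), integral_add h12 ht, integral_sub (iA t) (iS t),
      integral_congr_ae (ae_of_all _ fun x => real_inner_self_eq_norm_sq (ψ t x))]
  -- time integrability of the four slice terms
  have IA : IntegrableOn (fun t => ∫ x, ⟪ψ t x, FunctionSpaces.Torus.timeDeriv ψ t x⟫_ℝ) (Ioo 0 T) :=
    integrableOn_integral_inner_of_continuous hψ hψ.timeDeriv.continuous_uncurry
  have IS : IntegrableOn (fun t => ∫ x, ‖ψ t x‖ ^ 2) (Ioo 0 T) := by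
    refine (integrableOn_integral_inner_of_continuous hψ hcψ).congr (ae_of_all _ fun t => ?_)
    exact integral_congr_ae (ae_of_all _ fun x => real_inner_self_eq_norm_sq (ψ t x))
  have IC : IntegrableOn (fun t => ∫ x, ⟪ψ t x, FunctionSpaces.Torus.convect (b t) (ψ t) x⟫_ℝ) (Ioo 0 T) :=
    hprod.integral_prod_left
  have IL : IntegrableOn (fun t => ∫ x, ⟪ψ t x, viscAdj 𝔸 (ψ t) x⟫_ℝ) (Ioo 0 T) :=
    integrableOn_integral_inner_of_continuous hψ hV.continuous_uncurry
  -- assemble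
  have H12 : IntegrableOn (fun t => (∫ x, ⟪ψ t x, FunctionSpaces.Torus.timeDeriv ψ t x⟫_ℝ) - ∫ x, ‖ψ t x‖ ^ 2) (Ioo 0 T) :=
    IA.sub IS
  have H123 : IntegrableOn (fun t => (∫ x, ⟪ψ t x, FunctionSpaces.Torus.timeDeriv ψ t x⟫_ℝ) - (∫ x, ‖ψ t x‖ ^ 2) +
      ∫ x, ⟪ψ t x, FunctionSpaces.Torus.convect (b t) (ψ t) x⟫_ℝ) (Ioo 0 T) := H12.add IC
  rw [integral_congr_ae hslice, integral_add H123 IL, integral_add H12 IC, integral_sub IA IS,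
    setIntegral_integral_inner_timeDeriv_self hψ hT, setIntegral_integral_inner_convect_self_eq_zero hψ hbdiv]
  have hL0 := setIntegral_integral_inner_viscAdj_self_nonpos h𝔸 hlo hψ hψdiv
  linarith

end Torus

end Literature.Analysis.FluidPDE

end
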